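import Mathlib

/-!
# PneNP / OverlapGapAlgebra — crux `SolvableImpliesStableSection` (stmt-PneNP-2463):
# the UNIT CLAUSE block (15/·) — the threshold constant and the rates

Support for crux `stmt-PneNP-2463` (`Summit.PneNP.PneNP.Theses.OverlapGapAlgebra.SolvableImpliesStableSection`),
registered stub `stub_lowDensity` (child G).  Two pieces of real analysis for the assembly of the block:
(i) the sharp constant of the first-moment step, `u·s^{k-2} ≤ M_k·(u+s)^{k-1}` with
`M_k = (k-2)^{k-2}/(k-1)^{k-1}` (weighted AM–GM) — with it the contraction factor of the block is
`β = α·k(k-1)·2^{1-k}·M_k = α/α_UC(k)`, `α_UC(k) = (2^{k-1}/k)((k-1)/(k-2))^{k-2}` the Chao–Franco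
unit-clause threshold, and `α < 2^k/k` gives `β < 1` since `((k-1)/(k-2))^{k-2} ≥ 2`;
(ii) the rates: with windows `W = n/R + 1`, first-moment level `a = βW/(1-β)` and second-moment
level `q = (a + β²(W² + 2Wa))/(1-β²)`, a bound of the shape `R·(W² + 2Wa + q)·D₁/n + D₀` is at most
`(ν/2)(αn - 1)` for a suitable fixed `R` and all large `n`.

* `sissU_amgm`, `sissU_threshold_of_density_lt`, `sissU_rates`.
Pure real analysis; no definitions; axioms `propext`, `Classical.choice`, `Quot.sound`.
-/

set_option linter.dupNamespace false -- `Summit.PneNP.PneNP.…`: summit = sub-problem (D-0017)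

namespace Summit.PneNP.PneNP.Theorems

open Finset Filter
open scoped Classical

section Rates

/-- **Weighted AM–GM for the unit-clause constant.** For `k ≥ 3` and `u, s ≥ 0`:
`(k-1)^{k-1}·u·s^{k-2} ≤ (k-2)^{k-2}·(u+s)^{k-1}`. -/
theorem sissU_amgm (k : ℕ) (hk : 3 ≤ k) (u s : ℝ) (hu : 0 ≤ u) (hs : 0 ≤ s) :
    ((k : ℝ) - 1) ^ (k - 1) * u * s ^ (k - 2) ≤ ((k : ℝ) - 2) ^ (k - 2) * (u + s) ^ (k - 1) := by
  have hk1 : (0 : ℝ) < (k : ℝ) - 1 := by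
    have : (3 : ℝ) ≤ k := by exact_mod_cast hk
    linarith
  have hk2 : (0 : ℝ) < (k : ℝ) - 2 := by
    have : (3 : ℝ) ≤ k := by exact_mod_cast hk
    linarith
  -- weights and points
  set w₁ : ℝ := 1 / ((k : ℝ) - 1) with hw₁
  set w₂ : ℝ := ((k : ℝ) - 2) / ((k : ℝ) - 1) with hw₂
  set p₁ : ℝ := ((k : ℝ) - 1) * u with hp₁
  set p₂ : ℝ := ((k : ℝ) - 1) * s / ((k : ℝ) - 2) with hp₂
  have hw₁0 : 0 ≤ w₁ := by positivity
  have hw₂0 : 0 ≤ w₂ := by positivity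
  have hp₁0 : 0 ≤ p₁ := by positivity
  have hp₂0 : 0 ≤ p₂ := by positivity
  have hw : w₁ + w₂ = 1 := by
    rw [hw₁, hw₂]; field_simp; ring
  have hamgm := Real.geom_mean_le_arith_mean2_weighted hw₁0 hw₂0 hp₁0 hp₂0 hw
  have hrhs : w₁ * p₁ + w₂ * p₂ = u + s := by
    rw [hw₁, hw₂, hp₁, hp₂]; field_simp
  rw [hrhs] at hamgm
  -- raise to the power `k - 1`
  have hpow := pow_le_pow_left₀ (by positivity) hamgm (k - 1)
  have hlhs : (p₁ ^ w₁ * p₂ ^ w₂) ^ (k - 1) = p₁ * p₂ ^ (k - 2) := by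
    rw [mul_pow, ← Real.rpow_natCast (p₁ ^ w₁), ← Real.rpow_natCast (p₂ ^ w₂), ← Real.rpow_mul hp₁0,
      ← Real.rpow_mul hp₂0]
    have e1 : w₁ * ((k - 1 : ℕ) : ℝ) = 1 := by
      rw [hw₁, Nat.cast_sub (by omega), Nat.cast_one]; field_simp
    have e2 : w₂ * ((k - 1 : ℕ) : ℝ) = ((k - 2 : ℕ) : ℝ) := by
      rw [hw₂, Nat.cast_sub (by omega), Nat.cast_sub (by omega), Nat.cast_one, Nat.cast_two]; field_simp
    rw [e1, e2, Real.rpow_one, Real.rpow_natCast]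
  rw [hlhs, hp₁, hp₂, div_pow] at hpow
  -- clear the denominator `(k-2)^{k-2}`
  have hden : (0 : ℝ) < ((k : ℝ) - 2) ^ (k - 2) := by positivity
  have key : ((k : ℝ) - 1) * u * ((((k : ℝ) - 1) * s) ^ (k - 2)) ≤ (u + s) ^ (k - 1) * ((k : ℝ) - 2) ^ (k - 2) := by
    have := mul_le_mul_of_nonneg_right hpow hden.le
    rwa [mul_assoc, div_mul_cancel₀ _ hden.ne'] at this
  rw [mul_pow] at key
  have hk1' : (k : ℝ) - 1 = ((k : ℝ) - 1) ^ 1 := (pow_one _).symm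
  calc ((k : ℝ) - 1) ^ (k - 1) * u * s ^ (k - 2)
      = ((k : ℝ) - 1) * u * (((k : ℝ) - 1) ^ (k - 2) * s ^ (k - 2)) := by
        have : ((k : ℝ) - 1) ^ (k - 1) = ((k : ℝ) - 1) * ((k : ℝ) - 1) ^ (k - 2) := by
          rw [← pow_succ']; congr 1; omega
        rw [this]; ring
    _ ≤ (u + s) ^ (k - 1) * ((k : ℝ) - 2) ^ (k - 2) := key
    _ = _ := by ring

/-- **The unit-clause constant in the form used by the first moment.** For `k ≥ 3` and naturals
`u + s = n`: `u·s^{k-2} ≤ M_k·n^{k-1}` with `M_k = (k-2)^{k-2}/(k-1)^{k-1}`. -/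
theorem sissU_hM (k : ℕ) (hk : 3 ≤ k) (n : ℕ) :
    ∀ u s : ℕ, u + s = n → (u : ℝ) * (s : ℝ) ^ (k - 2) ≤
      (((k : ℝ) - 2) ^ (k - 2) / ((k : ℝ) - 1) ^ (k - 1)) * (n : ℝ) ^ (k - 1) := by
  intro u s hus
  have hk1 : (0 : ℝ) < ((k : ℝ) - 1) ^ (k - 1) := by
    have : (3 : ℝ) ≤ k := by exact_mod_cast hk
    have : (0 : ℝ) < (k : ℝ) - 1 := by linarith
    positivity
  have h := sissU_amgm k hk u s (Nat.cast_nonneg u) (Nat.cast_nonneg s)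
  rw [← hus, Nat.cast_add, div_mul_eq_mul_div, le_div_iff₀ hk1]
  calc (u : ℝ) * (s : ℝ) ^ (k - 2) * ((k : ℝ) - 1) ^ (k - 1)
      = ((k : ℝ) - 1) ^ (k - 1) * u * (s : ℝ) ^ (k - 2) := by ring
    _ ≤ _ := h

/-- **`α < 2^k/k` is below the unit-clause threshold.** For `k ≥ 3` and `0 < α < 2^k/k`:
`β = α·(k² - k)·2^{1-k}·M_k < 1`, written multiplicatively. -/
theorem sissU_threshold_of_density_lt (k : ℕ) (hk : 3 ≤ k) (α : ℝ) (hα : 0 < α)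
    (hαk : α < (2 : ℝ) ^ k / k) :
    α * ((k * k - k : ℕ) : ℝ) * (2 * (((k : ℝ) - 2) ^ (k - 2) / ((k : ℝ) - 1) ^ (k - 1))) < (2 : ℝ) ^ k := by
  have hk3 : (3 : ℝ) ≤ k := by exact_mod_cast hk
  have hk0 : (0 : ℝ) < k := by linarith
  have hk1 : (0 : ℝ) < (k : ℝ) - 1 := by linarith
  have hk2 : (0 : ℝ) < (k : ℝ) - 2 := by linarith
  -- `((k-1)/(k-2))^{k-2} ≥ 2` (Bernoulli), i.e. `2 (k-2)^{k-2} ≤ (k-1)^{k-2}`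
  have hbern : 2 * ((k : ℝ) - 2) ^ (k - 2) ≤ ((k : ℝ) - 1) ^ (k - 2) := by
    have h1 : (1 : ℝ) + (k - 2 : ℕ) * (1 / ((k : ℝ) - 2)) ≤ (1 + 1 / ((k : ℝ) - 2)) ^ (k - 2) :=
      one_add_mul_le_pow (by rw [one_div]; exact (inv_nonneg.mpr hk2.le).trans' (by norm_num)) _
    have h2 : (1 : ℝ) + (k - 2 : ℕ) * (1 / ((k : ℝ) - 2)) = 2 := by
      rw [Nat.cast_sub (by omega), Nat.cast_two, one_div, mul_inv_cancel₀ hk2.ne']; norm_num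
    have h3 : (1 + 1 / ((k : ℝ) - 2)) = ((k : ℝ) - 1) / ((k : ℝ) - 2) := by
      rw [eq_div_iff hk2.ne', add_mul, one_mul, one_div, inv_mul_cancel₀ hk2.ne']; ring
    rw [h2, h3, div_pow, le_div_iff₀ (by positivity)] at h1
    exact h1
  have hkk : ((k * k - k : ℕ) : ℝ) = (k : ℝ) * ((k : ℝ) - 1) := by
    rw [Nat.cast_sub (Nat.le_mul_self k), Nat.cast_mul]; ring
  rw [hkk]
  have hpow : ((k : ℝ) - 1) ^ (k - 1) = ((k : ℝ) - 1) * ((k : ℝ) - 1) ^ (k - 2) := by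
    rw [← pow_succ']; congr 1; omega
  -- `(k-1)·2M_k ≤ 1`
  have hB : (0 : ℝ) < ((k : ℝ) - 1) ^ (k - 2) := by positivity
  have hprod : ((k : ℝ) - 1) * (2 * (((k : ℝ) - 2) ^ (k - 2) / ((k : ℝ) - 1) ^ (k - 1))) ≤ 1 := by
    rw [hpow]
    have : ((k : ℝ) - 1) * (2 * (((k : ℝ) - 2) ^ (k - 2) / (((k : ℝ) - 1) * ((k : ℝ) - 1) ^ (k - 2))))
        = (2 * ((k : ℝ) - 2) ^ (k - 2)) / ((k : ℝ) - 1) ^ (k - 2) := by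
      field_simp
    rw [this, div_le_one hB]
    exact hbern
  have hαk' : α * k < (2 : ℝ) ^ k := (lt_div_iff₀ hk0).mp hαk
  calc α * ((k : ℝ) * ((k : ℝ) - 1)) * (2 * (((k : ℝ) - 2) ^ (k - 2) / ((k : ℝ) - 1) ^ (k - 1)))
      = (α * k) * (((k : ℝ) - 1) * (2 * (((k : ℝ) - 2) ^ (k - 2) / ((k : ℝ) - 1) ^ (k - 1)))) := by ring
    _ ≤ (α * k) * 1 := mul_le_mul_of_nonneg_left hprod (by positivity)
    _ < (2 : ℝ) ^ k := by rw [mul_one]; exact hαk'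

/-- **The rates.** For `0 ≤ β < 1`, `D₁ ≥ 0`, `D₀` and `α, ν > 0` there is `R ≥ 1` such that for all
large `n`, with `W = n/R + 1`, `a = βW/(1-β)`, `q = (a + β²(W² + 2Wa))/(1-β²)`:
`R·(W² + 2Wa + q)·D₁/n + D₀ ≤ (ν/2)·(αn - 1)`. -/
theorem sissU_rates (β D₁ D₀ α ν : ℝ) (hβ0 : 0 ≤ β) (hβ1 : β < 1) (hD₁ : 0 ≤ D₁)
    (hα : 0 < α) (hν : 0 < ν) :
    ∃ R : ℕ, 1 ≤ R ∧ ∀ᶠ n : ℕ in atTop,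
      (R : ℝ) * (((n : ℝ) / R + 1) ^ 2 + 2 * ((n : ℝ) / R + 1) * (β * ((n : ℝ) / R + 1) / (1 - β)) +
          ((β * ((n : ℝ) / R + 1) / (1 - β)) + β ^ 2 * (((n : ℝ) / R + 1) ^ 2 +
            2 * ((n : ℝ) / R + 1) * (β * ((n : ℝ) / R + 1) / (1 - β)))) / (1 - β ^ 2)) * D₁ / n + D₀
        ≤ ν / 2 * (α * n - 1) := by
  have h1β : 0 < 1 - β := by linarith
  have h1β2 : 0 < 1 - β ^ 2 := by nlinarith
  -- the constants
  set ca : ℝ := 2 * β / (1 - β) with hca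
  have hca0 : 0 ≤ ca := by positivity
  set CQ : ℝ := (4 + 4 * ca) + (ca + β ^ 2 * (4 + 4 * ca)) / (1 - β ^ 2) with hCQ
  have hCQ0 : 0 ≤ CQ := by positivity
  -- choose `R` with `CQ·D₁/R ≤ αν/4`
  obtain ⟨R, hR⟩ := exists_nat_gt (4 * CQ * D₁ / (α * ν))
  have hRpos : (0 : ℝ) < R := lt_of_le_of_lt (by positivity) hR
  have hR1 : 1 ≤ R := by exact_mod_cast Nat.one_le_iff_ne_zero.mpr (by rintro rfl; simp at hRpos)
  refine ⟨R, hR1, ?_⟩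
  have hRle : CQ * D₁ / R ≤ α * ν / 4 := by
    rw [div_le_iff₀ hRpos]
    rw [div_lt_iff₀ (by positivity)] at hR
    nlinarith
  -- large `n`: `n ≥ R` and `D₀ + ν/2 ≤ αν n/4`
  have hlarge : ∀ᶠ n : ℕ in atTop, (4 * (D₀ + ν / 2) / (α * ν)) ≤ (n : ℝ) :=
    tendsto_natCast_atTop_atTop.eventually_ge_atTop _
  filter_upwards [hlarge, eventually_ge_atTop R] with n hn hnR
  have hnpos : (0 : ℝ) < n := by
    have : (R : ℝ) ≤ n := by exact_mod_cast hnR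
    linarith
  -- `x := n/R ≥ 1`, `W ≤ 2x`
  set x : ℝ := (n : ℝ) / R with hx
  have hx1 : 1 ≤ x := by
    rw [hx, le_div_iff₀ hRpos, one_mul]; exact_mod_cast hnR
  have hx0 : 0 ≤ x := le_trans zero_le_one hx1
  set W : ℝ := x + 1 with hW
  have hW2 : W ≤ 2 * x := by rw [hW]; linarith
  have hW0 : 0 ≤ W := by rw [hW]; linarith
  set a : ℝ := β * W / (1 - β) with ha
  have ha0 : 0 ≤ a := by positivity
  have hale : a ≤ ca * x := by
    rw [ha, hca, div_mul_eq_mul_div, div_le_div_iff_of_pos_right h1β]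
    nlinarith
  set Q₀ : ℝ := W ^ 2 + 2 * W * a with hQ₀
  have hQ₀le : Q₀ ≤ (4 + 4 * ca) * x ^ 2 := by
    rw [hQ₀]; nlinarith
  have hQ₀0 : 0 ≤ Q₀ := by positivity
  set q : ℝ := (a + β ^ 2 * Q₀) / (1 - β ^ 2) with hq
  have hqle : q ≤ ((ca + β ^ 2 * (4 + 4 * ca)) / (1 - β ^ 2)) * x ^ 2 := by
    rw [hq, div_mul_eq_mul_div, div_le_div_iff_of_pos_right h1β2]
    have hx2 : x ≤ x ^ 2 := by nlinarith
    nlinarith [mul_le_mul_of_nonneg_left hx2 hca0, sq_nonneg β]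
  have hQ : Q₀ + q ≤ CQ * x ^ 2 := by rw [hCQ]; nlinarith
  -- the left side
  have hlhs : (R : ℝ) * (Q₀ + q) * D₁ / n ≤ CQ * D₁ / R * n := by
    have h1 : (R : ℝ) * (Q₀ + q) * D₁ / n ≤ (R : ℝ) * (CQ * x ^ 2) * D₁ / n := by
      refine div_le_div_of_nonneg_right ?_ hnpos.le
      exact mul_le_mul_of_nonneg_right (mul_le_mul_of_nonneg_left hQ hRpos.le) hD₁
    refine h1.trans (le_of_eq ?_)
    rw [hx]
    field_simp
  have hfinal : CQ * D₁ / R * n + D₀ ≤ ν / 2 * (α * n - 1) := by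
    have h2 : CQ * D₁ / R * n ≤ α * ν / 4 * n := mul_le_mul_of_nonneg_right hRle hnpos.le
    rw [div_le_iff₀ (by positivity)] at hn
    linarith
  calc (R : ℝ) * (((n : ℝ) / R + 1) ^ 2 + 2 * ((n : ℝ) / R + 1) * (β * ((n : ℝ) / R + 1) / (1 - β)) +
          ((β * ((n : ℝ) / R + 1) / (1 - β)) + β ^ 2 * (((n : ℝ) / R + 1) ^ 2 +
            2 * ((n : ℝ) / R + 1) * (β * ((n : ℝ) / R + 1) / (1 - β)))) / (1 - β ^ 2)) * D₁ / n + D₀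
      = (R : ℝ) * (Q₀ + q) * D₁ / n + D₀ := by rw [hq, hQ₀, ha, hW, hx]
    _ ≤ CQ * D₁ / R * n + D₀ := by linarith [hlhs]
    _ ≤ _ := hfinal

end Rates

end Summit.PneNP.PneNP.Theorems
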